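import Mathlib.Analysis.Analytic.Basic
import Literature.Probability.RandomPlanarGeometry.ConformalRectangle
import Literature.Barriers.CriticalPhenomena.EmbeddingModulusUniqueness
import HarnessLib

/-!
# The conformal modulus of a sheared quadrilateral is real-analytic in the shear (Ahlfors–Bers)

Topic `Literature/Probability/RandomPlanarGeometry` (conformal rectangles and their Cardy
cross-ratio modulus: `ConformalRectangle.lean`, `ConformalRectangleProofs.lean`,
`CrossRatioContinuity.lean`). ONE named fact, no proof:

* `ShearCrossRatioAnalytic` — for every conformal rectangle `R'` there is a function `M : ℂ → ℝ`,
  real-analytic on the open upper half-plane `{α | 0 < im α}`, such that for every `α` with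
  `0 < im α`, every presentation `R` of the sheared quad `φ_α R'` (`φ_α = moduliShear α`,
  Beffara's `ℝ`-linear map `x + iy ↦ x + αy`; same carrier image and same four marked points) and
  every uniformizing datum `(φ, x)` of `R`, the Cardy cross-ratio is `crossRatio x = M α`.

Source. The Beltrami coefficient of `φ_α` is the constant `ν(α) = (i - α)/(i + α) ∈ 𝔻`, a
holomorphic function of `α ∈ ℍ`; if `(φ', x')` uniformizes `R'`, the quasiconformal map
`φ_α ∘ φ' : ℍ → φ_α R'` has coefficient `ν(α) · \overline{φ''}/φ''`, still holomorphic in `α` as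
an `L^∞`-valued map; by the **Ahlfors–Bers theorem on holomorphic dependence on parameters**
(L. V. Ahlfors, L. Bers, *Riemann's mapping theorem for variable metrics*, Ann. of Math. 72
(1960), Thm. 11 (and Thm. 10, continuity); L. V. Ahlfors, *Lectures on Quasiconformal Mappings*
(1966), Ch. V, Thm. 5; O. Lehto, K. I. Virtanen, *Quasiconformal Mappings in the Plane* (1973),
Ch. II §5 and Ch. V §6) the normalised solutions `W_α = w^{ν̂(α)}` of the Beltrami equation
(coefficient extended by reflection, fixing `0, 1, ∞`) depend holomorphically on `α` pointwise,
`(φ_α ∘ φ' ∘ W_α⁻¹, W_α ∘ x')` uniformizes `φ_α R'`, and so the modulus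
`M α = crossRatio (W_α ∘ x')` is real-analytic in `α`; independence of the presentation and of the
datum is the conformal invariance of the cross-ratio (`crossRatio_eq_of_isUniformizing_holds`).
CONTINUITY of `M` (Radó) is proved in the tree
(`ConformalRectangle.tendsto_crossRatio_of_tendstoUniformly`, `CrossRatioContinuity.lean`); no
quasiconformal / Beltrami-equation theory exists in the tree or in Mathlib (searched 2026-08-16:
`quasiconformal`, `Beltrami`, `holomorphic motion` — docstring mentions only), which is why the
analytic dependence is recorded as a named fact. It is the single classical input of the
accumulation step of line `Sketch` for the crux `CardySelfDualSegment.SegmentOpen`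
(stmt-CriticalPhenomena-5471, stub `stub_shearCrossRatioAnalytic`).

-- TODO(general form): Ahlfors–Bers prove holomorphic dependence of `w^{μ(t)}(z)` on `t` for any
-- holomorphic family `t ↦ μ(t) ∈ L^∞`, `‖μ(t)‖_∞ ≤ k < 1`; only the shear family is stated here.
-/

noncomputable section

namespace Literature.Probability.RandomPlanarGeometry

open Literature.Barriers.CriticalPhenomena (moduliShear)
open UpperHalfPlane (upperHalfPlaneSet)

/-- **Ahlfors–Bers for Beffara's shears** (named fact, not proved here): for every conformal
rectangle `R'` there is `M : ℂ → ℝ`, real-analytic on `{α : ℂ | 0 < α.im}` (`ℂ` as a real normed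
space), such that for all `α` with `0 < im α`, all conformal rectangles `R` with
`R.carrier = φ_α '' R'.carrier` and `R.pt i = φ_α (R'.pt i)` (`φ_α = moduliShear α`), and all
uniformizing data `(φ, x)` of `R`, `crossRatio x = M α` — the conformal modulus of the sheared
quadrilateral `φ_α R'` is a real-analytic function of the shear modulus `α`. Ahlfors–Bers, Ann. of
Math. 72 (1960), Thm. 11 (holomorphic dependence of `w^μ` on parameters) with Thm. 10; Ahlfors,
*Lectures on Quasiconformal Mappings* (1966), Ch. V Thm. 5; Lehto–Virtanen (1973), Ch. V §6.
[cite: AhlforsBers1960, Thm. 11] -/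
def ShearCrossRatioAnalytic : Prop :=
  ∀ R' : ConformalRectangle, ∃ M : ℂ → ℝ, AnalyticOnNhd ℝ M {α : ℂ | 0 < α.im} ∧
    ∀ α : ℂ, 0 < α.im → ∀ (R : ConformalRectangle)
      (φ : ConformalEquiv upperHalfPlaneSet R.carrier) (x : Fin 4 → ℝ),
      R.carrier = moduliShear α '' R'.carrier → (∀ i, R.pt i = moduliShear α (R'.pt i)) →
      R.IsUniformizing φ x → crossRatio x = M α

end Literature.Probability.RandomPlanarGeometry
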